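import Literature.NumberTheory.K2Lit.SiegelStandardIwasawaData
import Literature.NumberTheory.Automorphic.FinAdelicTotallyDisconnected
import Mathlib.Analysis.SpecialFunctions.Exponential
import Mathlib.Analysis.Calculus.InverseFunctionTheorem.FDeriv
import Mathlib.Topology.Algebra.ClopenNhdofOne
import Mathlib.Topology.Algebra.Module.FiniteDimension
import HarnessLib

/-!
# Lemma K-f: a continuous `K`-finite function for a STANDARD Iwasawa datum is smooth at the finite places
# (ruling «M-155j» deal J1(b), hLiu418 = stmt-HodgeConjecture-24832, Track B road `K2_Liu`)

Cell `hodgecm-mathlib`, crux hLiu418, route of record `HCCMUnconditional`; LEAD F0P6-plan (g11) ruling «M-155j» (memo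
`F0/P6/F0P6-plan-g11/RULING-M155j-S7-IwasawaStd.v1.F0P6-plan-g11.md`), deal J1(b); seat `hodgecm-mathlib-K2Liu-p03` (g4).  Companion of the DEFS leaf ★
`Literature/NumberTheory/K2Lit/SiegelStandardIwasawaData` (`IwasawaDatum.IsStd`: `𝒦.K = C_∞·C_f` with `C_f` OPEN in `H(𝔸_f)`).

**`exists_isOpen_forall_mul_eq_of_isStd`** — for a standard Iwasawa datum `𝒦` of the doubled unitary group `H(𝔸)` and a CONTINUOUS
`φ : H(𝔸) → ℂ` whose right `𝒦.K`-translates span a finite-dimensional space (★ `IsKFinite 𝒦 φ`), there is an OPEN subgroup `U ≤ H(𝔸_f)` with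
`φ(h·k) = φ(h)` for all `h ∈ H(𝔸)` and all `k = (1, u)`, `u ∈ U` (trivial archimedean component ★ `archPart`, finite component ★ `finPart` in `U`): `K`-finite continuous sections for standard data are SMOOTH at the finite places, i.e. fixed by an open
compact subgroup — the notion print works with ([BorelJacquet1979 §4.1], [Tan1999 §1], [HarrisKudlaSweet1996 (1.16)]).  This is the finite half of the
«Lemma K» of the #42S census (S7); the archimedean half is vacuous for standard data by (P2) of `IsStd`.

PROOF.  §1 NO SMALL SUBGROUPS in a complete normed `ℂ`-algebra `𝔸`: there is a neighbourhood `U` of `1` such that `a = 1` whenever all powers `a^k`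
(`k ≥ 1`) lie in `U` — `U = exp(B(0,r))` with `2r` inside the injectivity neighbourhood of `exp` at `0` (Mathlib's inverse function theorem
`HasStrictFDerivAt.toOpenPartialHomeomorph` on `hasStrictFDerivAt_exp_zero`, and `exp (k•X) = (exp X)^k`); [MontgomeryZippin1955 §2.11], [BorelJacquet1979 §1.1].
§2 The finite part `C_f` of a standard datum is a COMPACT (image of `𝒦.K` under ★ `finPart`), totally disconnected (★ `totallyDisconnectedSpace_finAdelic`)
topological group acting `ℂ`-linearly on the finite-dimensional span `V` of the right translates of `φ` by `(R_u ψ)(h) = ψ(h·(1,u))` ((1,u) ∈ 𝒦.K by ★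
`IsStd.exists_fin`); every `ψ ∈ V` is continuous, so the orbit maps `u ↦ R_u ψ` are continuous for the topology of pointwise convergence, which on the
finite-dimensional Hausdorff `V` is THE vector-space topology (Mathlib `LinearMap.continuous_of_finiteDimensional`): in coordinates `R` is a continuous
homomorphism `C_f → End(ℂ^d)`.  §3 By §1 and Mathlib's `exist_openSubgroup_sub_clopen_nhds_of_one` (compact groups) on a clopen neighbourhood inside
`R⁻¹(U)` (`compact_exists_isClopen_in_isOpen`), an OPEN subgroup of `C_f` acts trivially on `V ∋ φ`; its image in `H(𝔸_f)` is open because `C_f` is.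
[cite: BorelJacquet1979, §1.1, §4.1] [cite: Tan1999, §1 p. 166] [cite: HarrisKudlaSweet1996, §1 (1.16)] [cite: MontgomeryZippin1955, §2.11]

No definition, no instance, no named fact, no `sorry`; axioms ⊆ {propext, Classical.choice, Quot.sound}.

## References
* [BorelJacquet1979] A. Borel, H. Jacquet, *Automorphic forms and automorphic representations*, Proc. Symp. Pure Math. 33.1 (1979), §1.1 (no small
  subgroups ∕ `K`-finite vectors), §4.1 (adelic groups).
* [Tan1999] V. Tan, Canad. J. Math. 51 (1999), §1 p. 166 (standard sections).
* [HarrisKudlaSweet1996] M. Harris, S. Kudla, W. J. Sweet, J. AMS 9 (1996), §1 (1.16).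
* [MontgomeryZippin1955] D. Montgomery, L. Zippin, *Topological Transformation Groups* (1955), §2.11 (Lie groups have no small subgroups).

HONEST LABEL: HC_CM is proved only modulo the 7 printed citations (2 remaining named inputs: hLiu418 = stmt-HodgeConjecture-24832, h413 =
stmt-HodgeConjecture-24833) until rung 0 closes; this helper moves no counter.
-/

set_option autoImplicit false

set_option linter.dupNamespace false

noncomputable section

open scoped Matrix Topology
open NumberField Filter Set Metric

namespace Summit.HodgeConjecture.HodgeConjecture.Cruxes.HLiu418.K2LiuIwasawaDatumStdSmooth

open Literature.NumberTheory.Automorphic Literature.NumberTheory.GaloisRepresentations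
open Literature.NumberTheory.GelbartRogawski1991 Literature.NumberTheory.GelbartRogawski1991.GRConstruction
open Literature.NumberTheory.K2Lit.SiegelDoubled

/-! ## §1 No small subgroups in a Banach algebra -/

/-- **No small subgroups**: in a complete normed `ℂ`-algebra there is a neighbourhood `U` of `1` containing no non-trivial «cyclic semigroup» — if
`a, a², a³, …` all lie in `U` then `a = 1`.  (`U = exp(B(0,r))` with `B(0,2r)` inside the injectivity domain of `exp` at `0`: `a = exp X`, `‖X‖ < r`,
`X ≠ 0`; the first multiple `k•X` of norm `≥ r` has norm `< 2r` and `exp(k•X) = a^k = exp Y` with `‖Y‖ < r` contradicts injectivity.)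
[cite: MontgomeryZippin1955, §2.11] [cite: BorelJacquet1979, §1.1] -/
theorem exists_nhds_one_forall_pow_mem_imp_eq_one (𝔸 : Type*) [NormedRing 𝔸] [NormedAlgebra ℂ 𝔸] [CompleteSpace 𝔸] :
    ∃ U ∈ 𝓝 (1 : 𝔸), ∀ a : 𝔸, (∀ k : ℕ, a ^ (k + 1) ∈ U) → a = 1 := by
  -- the functional equation of `exp` is stated over `ℚ`-algebras in Mathlib
  letI : NormedAlgebra ℚ 𝔸 := NormedAlgebra.restrictScalars ℚ ℂ 𝔸
  -- the local homeomorphism `exp` at `0`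
  have hd : HasStrictFDerivAt (NormedSpace.exp : 𝔸 → 𝔸) ((ContinuousLinearEquiv.refl ℂ 𝔸 : 𝔸 ≃L[ℂ] 𝔸) : 𝔸 →L[ℂ] 𝔸) 0 := by
    rw [ContinuousLinearEquiv.coe_refl, ← ContinuousLinearMap.one_def]
    exact hasStrictFDerivAt_exp_zero
  set P := hd.toOpenPartialHomeomorph (NormedSpace.exp : 𝔸 → 𝔸) with hP
  have hP0 : (0 : 𝔸) ∈ P.source := hd.mem_toOpenPartialHomeomorph_source
  have hPexp : ∀ x, P x = NormedSpace.exp x := fun x => rfl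
  -- a ball `B(0, 2r)` inside the source
  obtain ⟨ρ, hρ, hball⟩ := Metric.isOpen_iff.1 P.open_source 0 hP0
  set r : ℝ := ρ / 2 with hr
  have hr0 : 0 < r := by positivity
  have hsub : ball (0 : 𝔸) (2 * r) ⊆ P.source := by
    have h2 : 2 * r = ρ := by rw [hr]; ring
    rw [h2]; exact hball
  -- the neighbourhood `U = exp(B(0,r))` of `1`
  refine ⟨NormedSpace.exp '' ball (0 : 𝔸) r, ?_, fun a ha => ?_⟩
  · have h1 : P '' ball (0 : 𝔸) r ∈ 𝓝 (P 0) := P.image_mem_nhds hP0 (ball_mem_nhds _ hr0)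
    rwa [hPexp, NormedSpace.exp_zero] at h1
  -- `a = exp X` with `‖X‖ < r`
  obtain ⟨X, hX, hXa⟩ := (show a ∈ NormedSpace.exp '' ball (0 : 𝔸) r from by simpa using ha 0)
  rw [mem_ball_zero_iff] at hX
  by_cases hX0 : X = 0
  · rw [← hXa, hX0, NormedSpace.exp_zero]
  · exfalso
    have hXpos : 0 < ‖X‖ := norm_pos_iff.2 hX0
    -- the first multiple of `X` of norm at least `r`
    obtain ⟨k, hk, hk'⟩ : ∃ k : ℕ, r ≤ (k + 1 : ℝ) * ‖X‖ ∧ (k : ℝ) * ‖X‖ < r := by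
      classical
      have hex : ∃ k : ℕ, r ≤ (k + 1 : ℝ) * ‖X‖ := by
        obtain ⟨k, hk⟩ := exists_nat_ge (r / ‖X‖)
        exact ⟨k, by rw [div_le_iff₀ hXpos] at hk; nlinarith⟩
      refine ⟨Nat.find hex, Nat.find_spec hex, ?_⟩
      rcases Nat.eq_zero_or_pos (Nat.find hex) with h0 | hpos
      · rw [h0, Nat.cast_zero, zero_mul]; exact hr0
      · have hlt := not_le.1 (Nat.find_min hex (Nat.sub_one_lt_of_lt hpos))
        have hcast : ((Nat.find hex - 1 : ℕ) : ℝ) + 1 = (Nat.find hex : ℝ) := by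
          rw [Nat.cast_sub hpos, Nat.cast_one]; ring
        rw [hcast] at hlt
        exact hlt
    have hnorm : ‖((k + 1 : ℕ) : ℂ) • X‖ = (k + 1 : ℝ) * ‖X‖ := by
      rw [norm_smul, Complex.norm_natCast, Nat.cast_add, Nat.cast_one]
    have hmem1 : ((k + 1 : ℕ) : ℂ) • X ∈ P.source := hsub (by
      rw [mem_ball_zero_iff, hnorm]
      nlinarith)
    -- `a^(k+1) = exp Y` with `‖Y‖ < r`
    obtain ⟨Y, hY, hYa⟩ := (show a ^ (k + 1) ∈ NormedSpace.exp '' ball (0 : 𝔸) r from ha k)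
    rw [mem_ball_zero_iff] at hY
    have hmem2 : Y ∈ P.source := hsub (by rw [mem_ball_zero_iff]; linarith)
    -- `exp ((k+1)•X) = a^(k+1) = exp Y`, so `(k+1)•X = Y` by injectivity
    have heq : NormedSpace.exp (((k + 1 : ℕ) : ℂ) • X) = NormedSpace.exp Y := by
      rw [Nat.cast_smul_eq_nsmul, NormedSpace.exp_nsmul, hXa, hYa]
    have hinj := P.injOn hmem1 hmem2 (by rw [hPexp, hPexp, heq])
    have : (k + 1 : ℝ) * ‖X‖ < r := by rw [← hnorm, hinj]; exact hY
    linarith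

/-- **Open kernel**: a continuous multiplicative map `T` from a COMPACT, Hausdorff, TOTALLY DISCONNECTED topological group `G` to a complete normed
`ℂ`-algebra (`T 1 = 1`, `T (uv) = T u · T v`) is trivial on an OPEN subgroup of `G` — a clopen neighbourhood of `1` inside `T⁻¹(U)` for the
no-small-subgroups neighbourhood `U` of §1 (Mathlib `compact_exists_isClopen_in_isOpen`) contains an open subgroup (Mathlib
`IsTopologicalGroup.exist_openSubgroup_sub_clopen_nhds_of_one`), all of whose elements have all their powers in `U`.
[cite: MontgomeryZippin1955, §2.11] [cite: BorelJacquet1979, §1.1] -/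
theorem exists_openSubgroup_forall_eq_one {G : Type*} [Group G] [TopologicalSpace G] [IsTopologicalGroup G] [CompactSpace G]
    [T2Space G] [TotallyDisconnectedSpace G] {𝔸 : Type*} [NormedRing 𝔸] [NormedAlgebra ℂ 𝔸] [CompleteSpace 𝔸]
    (T : G → 𝔸) (hT1 : T 1 = 1) (hTmul : ∀ u v, T (u * v) = T u * T v) (hTc : Continuous T) :
    ∃ H : OpenSubgroup G, ∀ u ∈ H, T u = 1 := by
  have hTpow : ∀ (u : G) (k : ℕ), T (u ^ k) = T u ^ k := by
    intro u k
    induction k with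
    | zero => rw [pow_zero, pow_zero, hT1]
    | succ k ih => rw [pow_succ, pow_succ, hTmul, ih]
  obtain ⟨U₀, hU₀, hnss⟩ := exists_nhds_one_forall_pow_mem_imp_eq_one 𝔸
  have hpre : T ⁻¹' U₀ ∈ 𝓝 (1 : G) := hTc.continuousAt.preimage_mem_nhds (by rwa [hT1])
  obtain ⟨O, hOsub, hOo, h1O⟩ := mem_nhds_iff.1 hpre
  obtain ⟨W, hW, h1W, hWO⟩ := compact_exists_isClopen_in_isOpen hOo h1O
  obtain ⟨Hs, hHs⟩ := IsTopologicalGroup.exist_openSubgroup_sub_clopen_nhds_of_one hW h1W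
  refine ⟨Hs, fun u hu => hnss (T u) fun k => ?_⟩
  rw [← hTpow]
  exact hOsub (hWO (hHs (Hs.toSubgroup.pow_mem hu (k + 1))))

/-- **Finite-dimensional actions of profinite groups have open kernels**: a pointwise-continuous action `ρ` of a compact, Hausdorff, totally
disconnected group `G` by `ℂ`-linear maps on a finite-dimensional Hausdorff topological vector space `V` (`ρ 1 = id`, `ρ (uv) = ρ u ∘ ρ v`,
`u ↦ ρ u w` continuous for every `w`) is TRIVIAL on an open subgroup of `G`.  In coordinates (Mathlib `Module.finBasis`, `Basis.equivFun`, whose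
coordinate map is continuous on a finite-dimensional Hausdorff space: `LinearMap.continuous_of_finiteDimensional`) `ρ` is a continuous homomorphism
`G → End(ℂ^d)` (continuity tested on vectors, `continuous_clm_apply`), to which `exists_openSubgroup_forall_eq_one` applies.
[cite: BorelJacquet1979, §1.1] [cite: MontgomeryZippin1955, §2.11] -/
theorem exists_openSubgroup_forall_apply_eq_self {G : Type*} [Group G] [TopologicalSpace G] [IsTopologicalGroup G] [CompactSpace G]
    [T2Space G] [TotallyDisconnectedSpace G] {V : Type*} [AddCommGroup V] [Module ℂ V] [TopologicalSpace V] [IsTopologicalAddGroup V]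
    [ContinuousSMul ℂ V] [T2Space V] [FiniteDimensional ℂ V]
    (ρ : G → V →ₗ[ℂ] V) (hρ1 : ∀ w, ρ 1 w = w) (hρmul : ∀ u v w, ρ (u * v) w = ρ u (ρ v w)) (hρc : ∀ w, Continuous fun u => ρ u w) :
    ∃ H : OpenSubgroup G, ∀ u ∈ H, ∀ w, ρ u w = w := by
  -- coordinates: a basis `b` of `V`, `E := Fin d → ℂ`, and the conjugated operators `T u ∈ E →L E` (kept opaque)
  obtain ⟨b⟩ : Nonempty (Module.Basis (Fin (Module.finrank ℂ V)) ℂ V) := ⟨Module.finBasis ℂ V⟩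
  obtain ⟨T, hTapp⟩ : ∃ T : G → ((Fin (Module.finrank ℂ V) → ℂ) →L[ℂ] (Fin (Module.finrank ℂ V) → ℂ)),
      ∀ u x, T u x = b.equivFun (ρ u (b.equivFun.symm x)) :=
    ⟨fun u => LinearMap.toContinuousLinearMap (b.equivFun.toLinearMap ∘ₗ ρ u ∘ₗ b.equivFun.symm.toLinearMap), fun _ _ => rfl⟩
  -- `T` is a monoid homomorphism
  have hT1 : T 1 = 1 := by
    ext x i
    show T 1 x i = x i
    rw [hTapp, hρ1, LinearEquiv.apply_symm_apply]
  have hTmul : ∀ u v : G, T (u * v) = T u * T v := by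
    intro u v
    ext x i
    show T (u * v) x i = T u (T v x) i
    rw [hTapp, hTapp, hTapp, LinearEquiv.symm_apply_apply, hρmul]
  -- `T` is continuous: on vectors, it is the continuous coordinate map after a continuous orbit map
  have hTc : Continuous T := by
    refine continuous_clm_apply.2 fun x => ?_
    have hfun : (fun u => T u x) = fun u => b.equivFun (ρ u (b.equivFun.symm x)) := funext fun u => hTapp u x
    rw [hfun]
    have hcoord : Continuous (b.equivFun : V → (Fin (Module.finrank ℂ V) → ℂ)) := b.equivFun.toLinearMap.continuous_of_finiteDimensional
    exact hcoord.comp (hρc _)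
  -- an open subgroup on which `T` is trivial
  obtain ⟨Hs, htriv⟩ := exists_openSubgroup_forall_eq_one T hT1 hTmul hTc
  refine ⟨Hs, fun u hu w => ?_⟩
  have h1 : T u (b.equivFun w) = b.equivFun w := by
    rw [htriv u hu]
    exact one_apply_eq_self _
  rw [hTapp, LinearEquiv.symm_apply_apply] at h1
  exact b.equivFun.injective h1

/-! ## §2–§3 Lemma K-f -/

variable {L : Type} [Field L] [NumberField L] [IsCMField L]
variable {N M n : ℕ} {e : Fin N × Fin M ≃ Fin n}
  {dV : Fin N → L} {hdV : ∀ i, IsCMField.complexConj L (dV i) = dV i}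
  {dW : Fin M → L} {hdW : ∀ i, IsCMField.complexConj L (dW i) = dW i}

/-- every element of the span of the right translates of a continuous `φ` is continuous. [folklore] -/
theorem continuous_of_mem_rightTranslateSpan (𝒦 : IwasawaDatum L e dV hdV dW hdW) {φ : HA L e dV hdV dW hdW → ℂ}
    (hφc : Continuous φ) {ψ : HA L e dV hdV dW hdW → ℂ} (hψ : ψ ∈ rightTranslateSpan 𝒦 φ) : Continuous ψ := by
  induction hψ using Submodule.span_induction with
  | mem x hx =>
    obtain ⟨k, rfl⟩ := hx
    exact hφc.comp (continuous_id.mul continuous_const)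
  | zero => exact continuous_const
  | add x y _ _ hx hy => exact hx.add hy
  | smul a x _ hx => exact continuous_const.mul hx

/-- **LEMMA K-f — `K`-finite continuous functions for a STANDARD Iwasawa datum are smooth at the finite places**: for `𝒦` standard
(★ `IwasawaDatum.IsStd`), `φ : H(𝔸) → ℂ` continuous and `K`-finite (★ `IsKFinite 𝒦 φ`), there is an OPEN subgroup `U ≤ H(𝔸_f)` such that
`φ(h · k) = φ(h)` for every `h` and every `k ∈ H(𝔸)` with trivial archimedean component and finite component in `U` (★ `archPart` ∕ `finPart`;
i.e. `k = (1, u)`, `u ∈ U`). [cite: BorelJacquet1979, §1.1, §4.1] [cite: Tan1999, §1 p. 166] [cite: HarrisKudlaSweet1996, §1 (1.16)] -/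
theorem exists_isOpen_forall_mul_eq_of_isStd {𝒦 : IwasawaDatum L e dV hdV dW hdW} (h𝒦 : 𝒦.IsStd)
    {φ : HA L e dV hdV dW hdW → ℂ} (hφ : IsKFinite 𝒦 φ) (hφc : Continuous φ) :
    ∃ U : Subgroup (UnitaryGroup.finAdelic (Fp L) L (IsCMField.complexConj L) (n + n) (hermD L e dV hdV dW hdW)),
      IsOpen (U : Set (UnitaryGroup.finAdelic (Fp L) L (IsCMField.complexConj L) (n + n) (hermD L e dV hdV dW hdW))) ∧
      ∀ k : HA L e dV hdV dW hdW,
        UnitaryGroup.archPart (Fp L) L (IsCMField.complexConj L) (n + n) (hermD L e dV hdV dW hdW) k = 1 →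
        UnitaryGroup.finPart (Fp L) L (IsCMField.complexConj L) (n + n) (hermD L e dV hdV dW hdW) k ∈ U →
        ∀ h : HA L e dV hdV dW hdW, φ (h * k) = φ h := by
  classical
  -- §2a the finite part `C_f` of the standard datum
  obtain ⟨Cfin, hCo, hCK, hKC⟩ := h𝒦.exists_fin
  -- the embedding `u ↦ (1, u)` read in `H(𝔸)` (kept opaque)
  obtain ⟨ι, hι⟩ : ∃ ι : UnitaryGroup.finAdelic (Fp L) L (IsCMField.complexConj L) (n + n) (hermD L e dV hdV dW hdW) → HA L e dV hdV dW hdW,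
      ∀ u, ι u = UnitaryGroup.finAdelicToAdelic (Fp L) L (IsCMField.complexConj L) (n + n) (hermD L e dV hdV dW hdW) u :=
    ⟨fun u => UnitaryGroup.finAdelicToAdelic (Fp L) L (IsCMField.complexConj L) (n + n) (hermD L e dV hdV dW hdW) u, fun _ => rfl⟩
  have hιfun : ι = fun u => UnitaryGroup.finAdelicToAdelic (Fp L) L (IsCMField.complexConj L) (n + n) (hermD L e dV hdV dW hdW) u := funext hι
  have hιc : Continuous ι := by
    rw [hιfun]
    exact UnitaryGroup.continuous_finAdelicToAdelic (Fp L) L (IsCMField.complexConj L) (n + n) (hermD L e dV hdV dW hdW)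
  have hιmul : ∀ u v, ι (u * v) = ι u * ι v := fun u v => by rw [hι, hι, hι, map_mul]; rfl
  have hι1 : ι 1 = 1 := by rw [hι, map_one]; rfl
  have hιK : ∀ u ∈ Cfin, ι u ∈ 𝒦.K := fun u hu => by rw [hι]; exact hCK u hu
  have hfinι : ∀ u, UnitaryGroup.finPart (Fp L) L (IsCMField.complexConj L) (n + n) (hermD L e dV hdV dW hdW) (ι u) = u := fun u => by
    rw [hι]; exact UnitaryGroup.finPart_finAdelicToAdelic (Fp L) L (IsCMField.complexConj L) (n + n) (hermD L e dV hdV dW hdW) u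
  -- `C_f` is compact: it is the image of the compact `𝒦.K` under the continuous `finPart`
  have hCeq : (Cfin : Set (UnitaryGroup.finAdelic (Fp L) L (IsCMField.complexConj L) (n + n) (hermD L e dV hdV dW hdW))) =
      UnitaryGroup.finPart (Fp L) L (IsCMField.complexConj L) (n + n) (hermD L e dV hdV dW hdW) '' (𝒦.K : Set (HA L e dV hdV dW hdW)) := by
    ext u
    refine ⟨fun hu => ⟨ι u, hιK u hu, hfinι u⟩, ?_⟩
    rintro ⟨k, hk, rfl⟩
    exact hKC k hk
  have hCcpt : IsCompact (Cfin : Set (UnitaryGroup.finAdelic (Fp L) L (IsCMField.complexConj L) (n + n) (hermD L e dV hdV dW hdW))) := by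
    rw [hCeq]
    exact 𝒦.isCompact_K.image (UnitaryGroup.continuous_finPart (Fp L) L (IsCMField.complexConj L) (n + n) (hermD L e dV hdV dW hdW))
  haveI : CompactSpace Cfin := isCompact_iff_compactSpace.1 hCcpt
  haveI : TotallyDisconnectedSpace (UnitaryGroup.finAdelic (Fp L) L (IsCMField.complexConj L) (n + n) (hermD L e dV hdV dW hdW)) :=
    UnitaryGroup.totallyDisconnectedSpace_finAdelic (Fp L) L (IsCMField.complexConj L) (n + n) (hermD L e dV hdV dW hdW)
  haveI : TotallyDisconnectedSpace Cfin := Subtype.totallyDisconnectedSpace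
  -- §2b the finite-dimensional span `V` of the right translates
  haveI hVfd : FiniteDimensional ℂ (rightTranslateSpan 𝒦 φ) := hφ
  -- right translation by `ι u` as a linear endomorphism of `H(𝔸) → ℂ` (kept opaque: only its action is used)
  obtain ⟨R, hRapp⟩ : ∃ R : UnitaryGroup.finAdelic (Fp L) L (IsCMField.complexConj L) (n + n) (hermD L e dV hdV dW hdW) →
      (HA L e dV hdV dW hdW → ℂ) →ₗ[ℂ] (HA L e dV hdV dW hdW → ℂ), ∀ u ψ h, R u ψ h = ψ (h * ι u) :=
    ⟨fun u =>
      { toFun := fun ψ h => ψ (h * ι u)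
        map_add' := fun _ _ => rfl
        map_smul' := fun _ _ => rfl }, fun _ _ _ => rfl⟩
  -- `R u` preserves `V` for `u ∈ C_f` (the translate by `k` goes to the translate by `ι u · k ∈ 𝒦.K`)
  have hRV : ∀ u ∈ Cfin, ∀ ψ ∈ rightTranslateSpan 𝒦 φ, R u ψ ∈ rightTranslateSpan 𝒦 φ := by
    intro u hu ψ hψ
    induction hψ using Submodule.span_induction with
    | mem x hx =>
      obtain ⟨k, rfl⟩ := hx
      refine Submodule.subset_span ⟨⟨ι u * (k : HA L e dV hdV dW hdW), 𝒦.K.mul_mem (hιK u hu) k.2⟩, funext fun h => ?_⟩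
      rw [hRapp]
      show φ (h * (ι u * (k : HA L e dV hdV dW hdW))) = φ (h * ι u * (k : HA L e dV hdV dW hdW))
      rw [mul_assoc]
    | zero => rw [map_zero]; exact Submodule.zero_mem _
    | add x y _ _ hx hy => rw [map_add]; exact Submodule.add_mem _ hx hy
    | smul a x _ hx => rw [map_smul]; exact Submodule.smul_mem _ a hx
  -- the restricted operators, `ρ u : V →ₗ V` for `u ∈ C_f` (kept opaque)
  obtain ⟨ρ, hρ⟩ : ∃ ρ : Cfin → (rightTranslateSpan 𝒦 φ →ₗ[ℂ] rightTranslateSpan 𝒦 φ),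
      ∀ (u : Cfin) (w : rightTranslateSpan 𝒦 φ) (h : HA L e dV hdV dW hdW),
        (ρ u w : HA L e dV hdV dW hdW → ℂ) h = (w : HA L e dV hdV dW hdW → ℂ) (h * ι u.1) :=
    ⟨fun u => (R u.1).restrict fun ψ hψ => hRV u.1 u.2 ψ hψ, fun u w h => by rw [LinearMap.coe_restrict_apply, hRapp]⟩
  have hρ1 : ∀ w, ρ 1 w = w := fun w => Subtype.ext (funext fun h => by
    rw [hρ]
    show (w : HA L e dV hdV dW hdW → ℂ) (h * ι 1) = _
    rw [hι1, mul_one])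
  have hρmul : ∀ (u v : Cfin) (w), ρ (u * v) w = ρ u (ρ v w) := fun u v w => Subtype.ext (funext fun h => by
    rw [hρ, hρ, hρ]
    show (w : HA L e dV hdV dW hdW → ℂ) (h * ι (u.1 * v.1)) = (w : HA L e dV hdV dW hdW → ℂ) (h * ι u.1 * ι v.1)
    rw [hιmul, mul_assoc])
  -- the orbit maps `u ↦ ρ u w ∈ V` are continuous for the (pointwise) subspace topology of `V`
  have hρc : ∀ w : rightTranslateSpan 𝒦 φ, Continuous fun u : Cfin => ρ u w := by
    intro w
    refine continuous_induced_rng.2 (continuous_pi fun h => ?_)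
    have hf : (fun u : Cfin => ((ρ u w : rightTranslateSpan 𝒦 φ) : HA L e dV hdV dW hdW → ℂ) h) =
        fun u : Cfin => (w : HA L e dV hdV dW hdW → ℂ) (h * ι u.1) :=
      funext fun u => hρ u w h
    show Continuous fun u : Cfin => ((ρ u w : rightTranslateSpan 𝒦 φ) : HA L e dV hdV dW hdW → ℂ) h
    rw [hf]
    exact (continuous_of_mem_rightTranslateSpan 𝒦 hφc w.2).comp (continuous_const.mul (hιc.comp continuous_subtype_val))
  -- §3 an open subgroup of `C_f` acting trivially on `V` (no small subgroups, in coordinates)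
  obtain ⟨Hs, htriv⟩ := exists_openSubgroup_forall_apply_eq_self ρ hρ1 hρmul hρc
  have hfix : ∀ u : Cfin, u ∈ Hs → ∀ h : HA L e dV hdV dW hdW, φ (h * ι u.1) = φ h := by
    intro u hu h
    have key := congrArg (fun w : rightTranslateSpan 𝒦 φ => (w : HA L e dV hdV dW hdW → ℂ) h)
      (htriv u hu ⟨φ, self_mem_rightTranslateSpan 𝒦 φ⟩)
    simp only [hρ] at key
    exact key
  -- the open subgroup `U := Hs` read in `H(𝔸_f)`
  refine ⟨Hs.toSubgroup.map Cfin.subtype, ?_, ?_⟩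
  · rw [Subgroup.coe_map]
    exact hCo.isOpenEmbedding_subtypeVal.isOpenMap _ Hs.isOpen
  · rintro k hk1 ⟨u, hu, huk⟩ h
    -- `k = (1, k_f) = ι u`
    have hk : ι (u : UnitaryGroup.finAdelic (Fp L) L (IsCMField.complexConj L) (n + n) (hermD L e dV hdV dW hdW)) = k := by
      have h1 := UnitaryGroup.archToAdelic_mul_finAdelicToAdelic (Fp L) L (IsCMField.complexConj L) (n + n) (hermD L e dV hdV dW hdW) k
      rw [hk1, map_one, one_mul, ← huk] at h1
      rw [hι]
      exact h1
    rw [← hk]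
    exact hfix u hu h

end Summit.HodgeConjecture.HodgeConjecture.Cruxes.HLiu418.K2LiuIwasawaDatumStdSmooth

end
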